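import Summits.QuantumFields.BalabanUV.T4Continuum.Support.MinimalActionMemClass
import Summits.QuantumFields.BalabanUV.T4Continuum.Support.NE3LocalCrudeEnd
import HarnessLib

/-!
# T⁴ programme, node NE3 — BOTH READINGS ON THE FIXED TORUS OVER B11's CLASS (6) AS PRINTED: `NE3Shape` BY NAME FROM (H∃),
# THE AVERAGING TRANSPORT (M2), THE REGIME AND P2's ROOT T-E

NE3 prover lineage P1, gen 18 (cell `pub-balaban`, unit `b2b-balaban-t4-ne3-p1`, row NE3 OWNER).

CONTENT (0 def, 0 sorry): the class-(6) twins of `NE3ShapeCrudeTorus.ne3Shape_thm1Type_crude`, composing part 4c's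
`MinimalActionMemClass.actionRate_thm1Type_mem` (route (A) over any class family containing the sandwich's two competitors) with
`NE3LocalCrudeEnd.ne3Shape_crude_of_actionRate` (reading (D), crude fixed-torus route): **`ne3Shape_thm1Type_crude_mem`** (generic `𝒞`
with the memberships (M1) `RegularSup B C_r ⇒ ∈ 𝒞` and (M2) «averaged regular minimiser ∈ 𝒞») and **`ne3Shape_classSix_crude`**
(`𝒞 = MinimalActionClassSix.ClassSix d L N ε₀` = B11's (6) with the lattice-current condition (1.9); (M1) discharged by the crew's
`mem_classSix_of_regularSup`).

HONEST FRAMING.  **NE3 is NOT proved**: (H∃) ([Balaban1985Variational] Thm 1 (8)+(9)+(10) p. 279 TYPE), (M2) ([Balaban1985RegularSpaces]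
Prop. 3 ∕ [Balaban1985Averaging] (128)–(129) TYPE) and T-E (`NE3EnergyShapes.NE3EnergyRate`, leaves ML = B9 Thm 3.3 TYPE, L1∕L2∕L11;
asserted only for the flat class) are HYPOTHESES over the tree's objects, asserted nowhere; the (D) constant is the crude fixed-torus
one (`∝ N⁴`); nothing printed is a hypothesis of a theorem; no conditional of the cell (`BetaPertH`, (B), (B^μ), G-an2-4); no `def`,
no `sorry`, axioms ⊆ {propext, Classical.choice, Quot.sound}.  Finite T⁴ rung (B)+1 — NOT infinite volume, NOT a mass gap, NOT the
Clay problem, NOT summit progress.  PLACEMENT: `Summits/QuantumFields/BalabanUV/`.  HONEST DEPENDENCY (cell page 1): continuum YM on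
T⁴ ⇐ BetaPertH ∧ nine spine estimates (0/9 proved); BetaPertH ⇐ (D1) ∧ (D4) ∧ CAP+tail; G-an2-4 gates asym, D1 and NE2/3/4.
-/

set_option autoImplicit false

open scoped BigOperators Matrix Matrix.Norms.L2Operator
open NormedSpace Finset

namespace Summit.QuantumFields.BalabanUV.T4Continuum.NE3ShapeClassSixTorus

open Literature.MathematicalPhysics.QuantumFieldTheory.Balaban1983to89
open B7Prop1Explicit B7Prop2Explicit
open T4AveragingDeficitWall hiding Site Plane Plaq Bond
open T4AveragingDeficitWallBoundary (periodBox)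
open T4AveragingDeficitNonAbelian (wallConstNA wallConstNA_nonneg wallConstLoc)
open AveragingDeficitDualResidual (dualC1 dualC2)
open AveragingDeficitDerivWallProof (wallConst)
open T4EtaRateMin (NE3Shape)
open MinimalActionSandwich MinimalActionRate MinimalActionRefine
open SkeletonPrecompGrad (gradRem)
open NE3EnergyShapes (NE3EnergyRate)
open MinimalActionMemClass (actionRate_thm1Type_mem)
open MinimalActionClassSix (ClassSix mem_classSix_of_regularSup)
open NE3LocalCrudeEnd (ne3Shape_crude_of_actionRate)

noncomputable section

variable {d : ℕ} {n : Type*} [Fintype n] [DecidableEq n] [Nonempty n]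

/-- **NE3 BY NAME ON THE FIXED TORUS, BOTH READINGS, OVER ANY CLASS FAMILY CONTAINING THE SANDWICH's TWO COMPETITORS** —
`NE3ShapeCrudeTorus.ne3Shape_thm1Type_crude` with the ball inclusion `sfClass ε ⊆ 𝒞` replaced by (M1) `RegularSup B C_r (j+1) U →
U ∈ 𝒞 (j+1)` and (M2) «the rescaled average of a regular run-`(k+1)` minimiser lies in `𝒞 k`», and thresholds (iv)(v) replaced by the
radius thresholds `(K_b + 8K_mL^{d+2})t ≤ B ≤ 1`, `(K_c + 36K_mL^{d+2})t ≤ C_r ≤ 1` of `MinimalActionMemClass.actionRate_thm1Type_mem`: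
(H∃)[choice form] ∧ (M1) ∧ (M2) ∧ T-E ∧ regime ⇒ `NE3Shape (minActReadings d 𝒞 L N dom loc_D) (max C_A K_D) (L⁻¹)` (`d = 4`,
`L ≥ 2`).  NE3 is NOT proved by this. [folklore] -/
theorem ne3Shape_thm1Type_crude_mem (hd4 : d = 4) {𝒞 : ℕ → Set (Site d → Fin d → (Matrix n n ℂ)ˣ)} {L N : ℕ}
    (hL : 2 ≤ L) (hN : 1 ≤ N) {b c t B C_r C : ℝ} (hb : 0 ≤ b) (hc : 0 ≤ c) (hbt : b ≤ t) (hct : c ≤ t) (hC : 0 ≤ C)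
    (hBle : B ≤ 1) (hCle : C_r ≤ 1)
    (hT1 : (160 * d + 168 * (d : ℝ) ^ 2 + 2 * (32 * d + (24 * d * (2 * (d : ℝ) + gradRem d) + 14336 * (d : ℝ) ^ 2 * ((d : ℝ) + 1) ^ 2)
            + 12 * (2 * (d : ℝ) + gradRem d))
        + 512 * ((d : ℝ) + 1) * ((d : ℝ) + 4) * (L : ℝ) ^ 2
          * (32 * d + 48 * d * (L : ℝ) ^ 2 * (2 * (d : ℝ) + gradRem d)
            + 8192 * (d : ℝ) ^ 2 * (2 * (d : ℝ) + 1) ^ 2 * (L : ℝ) ^ 2)) * t ≤ 1)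
    (hT2 : 2 ^ 15 * ((d : ℝ) + 1) ^ 2 * ((d : ℝ) + 4) ^ 2 * (L : ℝ) ^ 2 * t ≤ 1)
    (hT3 : 2 ^ 14 * ((d : ℝ) + 1) * ((d : ℝ) + 4) * (L : ℝ) ^ (2 * d + 3)
          * ((32 * d + 48 * d * (L : ℝ) ^ 2 * (2 * (d : ℝ) + gradRem d)
              + 8192 * (d : ℝ) ^ 2 * (2 * (d : ℝ) + 1) ^ 2 * (L : ℝ) ^ 2)
            + (3 * (1280 * d * ((d : ℝ) + 1) ^ 2 * ((d : ℝ) + 4) ^ 2 * (L : ℝ) ^ 2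
            * (32 * d + 48 * d * (L : ℝ) ^ 2 * (2 * (d : ℝ) + gradRem d)
              + 8192 * (d : ℝ) ^ 2 * (2 * (d : ℝ) + 1) ^ 2 * (L : ℝ) ^ 2) ^ 2
          + d * ((d : ℝ) + 1) * ((L : ℝ) ^ 3 * (256 * (d : ℝ) ^ 2
              * (32 * d + (24 * d * (2 * (d : ℝ) + gradRem d) + 14336 * (d : ℝ) ^ 2 * ((d : ℝ) + 1) ^ 2)
                + 12 * (2 * (d : ℝ) + gradRem d))
            + 4 * (24 * d * (2 * (d : ℝ) + gradRem d) + 14336 * (d : ℝ) ^ 2 * ((d : ℝ) + 1) ^ 2)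
            + 24 * (2 * (d : ℝ) + gradRem d)))
          + ((d : ℝ) - 1) ^ 2 * (37 * ((d : ℝ) - 1) + 5)))) * t ≤ 1)
    (hB : ((32 * d + 48 * d * (L : ℝ) ^ 2 * (2 * (d : ℝ) + gradRem d)
              + 8192 * (d : ℝ) ^ 2 * (2 * (d : ℝ) + 1) ^ 2 * (L : ℝ) ^ 2)
            + 8 * (3 * (1280 * d * ((d : ℝ) + 1) ^ 2 * ((d : ℝ) + 4) ^ 2 * (L : ℝ) ^ 2
            * (32 * d + 48 * d * (L : ℝ) ^ 2 * (2 * (d : ℝ) + gradRem d)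
              + 8192 * (d : ℝ) ^ 2 * (2 * (d : ℝ) + 1) ^ 2 * (L : ℝ) ^ 2) ^ 2
          + d * ((d : ℝ) + 1) * ((L : ℝ) ^ 3 * (256 * (d : ℝ) ^ 2
              * (32 * d + (24 * d * (2 * (d : ℝ) + gradRem d) + 14336 * (d : ℝ) ^ 2 * ((d : ℝ) + 1) ^ 2)
                + 12 * (2 * (d : ℝ) + gradRem d))
            + 4 * (24 * d * (2 * (d : ℝ) + gradRem d) + 14336 * (d : ℝ) ^ 2 * ((d : ℝ) + 1) ^ 2)
            + 24 * (2 * (d : ℝ) + gradRem d)))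
          + ((d : ℝ) - 1) ^ 2 * (37 * ((d : ℝ) - 1) + 5))) * (L : ℝ) ^ (d + 2)) * t ≤ B)
    (hCr : (((L : ℝ) ^ 3 * (256 * (d : ℝ) ^ 2
              * (32 * d + (24 * d * (2 * (d : ℝ) + gradRem d) + 14336 * (d : ℝ) ^ 2 * ((d : ℝ) + 1) ^ 2)
                + 12 * (2 * (d : ℝ) + gradRem d))
            + 4 * (24 * d * (2 * (d : ℝ) + gradRem d) + 14336 * (d : ℝ) ^ 2 * ((d : ℝ) + 1) ^ 2)
            + 24 * (2 * (d : ℝ) + gradRem d)))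
            + 36 * (3 * (1280 * d * ((d : ℝ) + 1) ^ 2 * ((d : ℝ) + 4) ^ 2 * (L : ℝ) ^ 2
            * (32 * d + 48 * d * (L : ℝ) ^ 2 * (2 * (d : ℝ) + gradRem d)
              + 8192 * (d : ℝ) ^ 2 * (2 * (d : ℝ) + 1) ^ 2 * (L : ℝ) ^ 2) ^ 2
          + d * ((d : ℝ) + 1) * ((L : ℝ) ^ 3 * (256 * (d : ℝ) ^ 2
              * (32 * d + (24 * d * (2 * (d : ℝ) + gradRem d) + 14336 * (d : ℝ) ^ 2 * ((d : ℝ) + 1) ^ 2)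
                + 12 * (2 * (d : ℝ) + gradRem d))
            + 4 * (24 * d * (2 * (d : ℝ) + gradRem d) + 14336 * (d : ℝ) ^ 2 * ((d : ℝ) + 1) ^ 2)
            + 24 * (2 * (d : ℝ) + gradRem d)))
          + ((d : ℝ) - 1) ^ 2 * (37 * ((d : ℝ) - 1) + 5))) * (L : ℝ) ^ (d + 2)) * t ≤ C_r)
    {dom : Set (Site d → Fin d → (Matrix n n ℂ)ˣ)} (hTE : NE3EnergyRate d 𝒞 L N b (gradConst d c) C dom)
    {sel : ℕ → (Site d → Fin d → (Matrix n n ℂ)ˣ) → (Site d → Fin d → (Matrix n n ℂ)ˣ)}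
    (hmin : ∀ V ∈ dom, ∀ k, IsMinimiser d 𝒞 L N k V (sel k V))
    (hreg : ∀ V ∈ dom, ∀ k, RegularSup d L N b c k (sel k V))
    (h4 : ∀ V ∈ dom, ∀ (k : ℕ) (U : Site d → Fin d → (Matrix n n ℂ)ˣ),
      IsMinimiser d 𝒞 L N (k + 1) V U → RegularSup d L N b c (k + 1) U → rescale L (bavg L U) ∈ 𝒞 k)
    (hRef : ∀ (j : ℕ) (U : Site d → Fin d → (Matrix n n ℂ)ˣ), RegularSup d L N B C_r (j + 1) U → U ∈ 𝒞 (j + 1)) :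
    NE3Shape
      (minActReadings d 𝒞 L N dom
        (fun k V (x : ↥(periodBox (d := d) N)) =>
          fineAction (sel k V) (((blockSites L)^[k] {(x : Site d)}) ×ˢ Finset.univ)))
      (max (wallConstNA d L * (gradConst d 1 + 1) / (L : ℝ) ^ 2)
        (wallConstLoc d L * (2500 * (L : ℝ) ^ 3 * Fintype.card (T4AveragingDeficitWall.Plane d) * (b * c + c ^ 2) + b ^ 3)
          + ((b + 23142400 * b ^ 2) * Real.sqrt (Fintype.card (T4AveragingDeficitWall.Plane d))
              * (C * (wallConst d L * (N : ℝ) ^ 2 * (Real.sqrt (gradConst d c) * dualC2 d L + 2 * b ^ 2 * dualC1 d L)))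
            + 14 * Fintype.card (T4AveragingDeficitWall.Plane d)
              * (C * (wallConst d L * (N : ℝ) ^ 2 * (Real.sqrt (gradConst d c) * dualC2 d L + 2 * b ^ 2 * dualC1 d L))) ^ 2)
        + Fintype.card (T4AveragingDeficitWall.Plane d) * b ^ 2))
      ((L : ℝ)⁻¹) := by
  subst hd4
  have hL1 : 1 ≤ L := le_trans (by norm_num) hL
  have hmin' : ∀ V ∈ dom, ∀ k, ∃ U, IsMinimiser 4 𝒞 L N k V U ∧ RegularSup 4 L N b c k U :=
    fun V hV k => ⟨sel k V, hmin V hV k, hreg V hV k⟩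
  have hA := actionRate_thm1Type_mem (d := 4) (by norm_num) hL1 hN hb hc hbt hct hBle hCle hT1 hT2 hT3 hB hCr hmin' h4 hRef
    (fun k V (x : ↥(periodBox (d := 4) N)) => fineAction (sel k V) (((blockSites L)^[k] {(x : Site 4)}) ×ˢ Finset.univ))
  -- the small-field side condition of the local half from threshold (ii)
  have hbs : 20480 * (L : ℝ) ^ 2 * b ≤ 1 := by
    have h2 := hT2
    norm_num at h2
    have hL2 : (0 : ℝ) ≤ (L : ℝ) ^ 2 := by positivity
    have h3 : (L : ℝ) ^ 2 * b ≤ (L : ℝ) ^ 2 * t := mul_le_mul_of_nonneg_left hbt hL2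
    have h4 : 0 ≤ (L : ℝ) ^ 2 * b := mul_nonneg hL2 hb
    nlinarith
  have hCA : 0 ≤ wallConstNA 4 L * (gradConst 4 1 + 1) / (L : ℝ) ^ 2 := by
    have := wallConstNA_nonneg (d := 4) L
    have := gradConst_nonneg (d := 4) (1 : ℝ)
    positivity
  exact ne3Shape_crude_of_actionRate hL hN hb hc hC hbs hTE hmin hreg hCA hA

/-- **NE3 BY NAME ON THE FIXED TORUS OVER B11's CLASS (6) AS PRINTED** (`𝒞 = ClassSix d L N ε₀`, `d = 4`, `L ≥ 2`): (M1) is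
DISCHARGED by the crew's `MinimalActionClassSix.mem_classSix_of_regularSup` (`0 ≤ B ≤ 1/4`, `B < ε₀`, `2(d−1)C_r < ε₀`); the typed
hypotheses are EXACTLY (H∃) (a selection of minimisers of Bałaban's variational problem over (6) with sup-form regularity —
[Balaban1985Variational] Thm 1 p. 279 TYPE), (M2) (averaging keeps a regular minimiser in (6) — [Balaban1985RegularSpaces] Prop. 3
TYPE) and T-E (P2's ROOT `NE3EnergyRate` over (6)), plus the explicit regime.  Conclusion:
`NE3Shape (minActReadings d (ClassSix d L N ε₀) L N dom loc_D) (max C_A K_D) (L⁻¹)`.  NE3 is NOT proved by this. [folklore] -/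
theorem ne3Shape_classSix_crude (hd4 : d = 4) {L N : ℕ} (hL : 2 ≤ L) (hN : 1 ≤ N) {b c t B C_r C ε₀ : ℝ}
    (hb : 0 ≤ b) (hc : 0 ≤ c) (hbt : b ≤ t) (hct : c ≤ t) (hC : 0 ≤ C) (hB0 : 0 ≤ B) (hB4 : B ≤ 1 / 4) (hBε : B < ε₀)
    (hCε : 2 * ((d : ℝ) - 1) * C_r < ε₀) (hCle : C_r ≤ 1)
    (hT1 : (160 * d + 168 * (d : ℝ) ^ 2 + 2 * (32 * d + (24 * d * (2 * (d : ℝ) + gradRem d) + 14336 * (d : ℝ) ^ 2 * ((d : ℝ) + 1) ^ 2)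
            + 12 * (2 * (d : ℝ) + gradRem d))
        + 512 * ((d : ℝ) + 1) * ((d : ℝ) + 4) * (L : ℝ) ^ 2
          * (32 * d + 48 * d * (L : ℝ) ^ 2 * (2 * (d : ℝ) + gradRem d)
            + 8192 * (d : ℝ) ^ 2 * (2 * (d : ℝ) + 1) ^ 2 * (L : ℝ) ^ 2)) * t ≤ 1)
    (hT2 : 2 ^ 15 * ((d : ℝ) + 1) ^ 2 * ((d : ℝ) + 4) ^ 2 * (L : ℝ) ^ 2 * t ≤ 1)
    (hT3 : 2 ^ 14 * ((d : ℝ) + 1) * ((d : ℝ) + 4) * (L : ℝ) ^ (2 * d + 3)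
          * ((32 * d + 48 * d * (L : ℝ) ^ 2 * (2 * (d : ℝ) + gradRem d)
              + 8192 * (d : ℝ) ^ 2 * (2 * (d : ℝ) + 1) ^ 2 * (L : ℝ) ^ 2)
            + (3 * (1280 * d * ((d : ℝ) + 1) ^ 2 * ((d : ℝ) + 4) ^ 2 * (L : ℝ) ^ 2
            * (32 * d + 48 * d * (L : ℝ) ^ 2 * (2 * (d : ℝ) + gradRem d)
              + 8192 * (d : ℝ) ^ 2 * (2 * (d : ℝ) + 1) ^ 2 * (L : ℝ) ^ 2) ^ 2
          + d * ((d : ℝ) + 1) * ((L : ℝ) ^ 3 * (256 * (d : ℝ) ^ 2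
              * (32 * d + (24 * d * (2 * (d : ℝ) + gradRem d) + 14336 * (d : ℝ) ^ 2 * ((d : ℝ) + 1) ^ 2)
                + 12 * (2 * (d : ℝ) + gradRem d))
            + 4 * (24 * d * (2 * (d : ℝ) + gradRem d) + 14336 * (d : ℝ) ^ 2 * ((d : ℝ) + 1) ^ 2)
            + 24 * (2 * (d : ℝ) + gradRem d)))
          + ((d : ℝ) - 1) ^ 2 * (37 * ((d : ℝ) - 1) + 5)))) * t ≤ 1)
    (hB : ((32 * d + 48 * d * (L : ℝ) ^ 2 * (2 * (d : ℝ) + gradRem d)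
              + 8192 * (d : ℝ) ^ 2 * (2 * (d : ℝ) + 1) ^ 2 * (L : ℝ) ^ 2)
            + 8 * (3 * (1280 * d * ((d : ℝ) + 1) ^ 2 * ((d : ℝ) + 4) ^ 2 * (L : ℝ) ^ 2
            * (32 * d + 48 * d * (L : ℝ) ^ 2 * (2 * (d : ℝ) + gradRem d)
              + 8192 * (d : ℝ) ^ 2 * (2 * (d : ℝ) + 1) ^ 2 * (L : ℝ) ^ 2) ^ 2
          + d * ((d : ℝ) + 1) * ((L : ℝ) ^ 3 * (256 * (d : ℝ) ^ 2
              * (32 * d + (24 * d * (2 * (d : ℝ) + gradRem d) + 14336 * (d : ℝ) ^ 2 * ((d : ℝ) + 1) ^ 2)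
                + 12 * (2 * (d : ℝ) + gradRem d))
            + 4 * (24 * d * (2 * (d : ℝ) + gradRem d) + 14336 * (d : ℝ) ^ 2 * ((d : ℝ) + 1) ^ 2)
            + 24 * (2 * (d : ℝ) + gradRem d)))
          + ((d : ℝ) - 1) ^ 2 * (37 * ((d : ℝ) - 1) + 5))) * (L : ℝ) ^ (d + 2)) * t ≤ B)
    (hCr : (((L : ℝ) ^ 3 * (256 * (d : ℝ) ^ 2
              * (32 * d + (24 * d * (2 * (d : ℝ) + gradRem d) + 14336 * (d : ℝ) ^ 2 * ((d : ℝ) + 1) ^ 2)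
                + 12 * (2 * (d : ℝ) + gradRem d))
            + 4 * (24 * d * (2 * (d : ℝ) + gradRem d) + 14336 * (d : ℝ) ^ 2 * ((d : ℝ) + 1) ^ 2)
            + 24 * (2 * (d : ℝ) + gradRem d)))
            + 36 * (3 * (1280 * d * ((d : ℝ) + 1) ^ 2 * ((d : ℝ) + 4) ^ 2 * (L : ℝ) ^ 2
            * (32 * d + 48 * d * (L : ℝ) ^ 2 * (2 * (d : ℝ) + gradRem d)
              + 8192 * (d : ℝ) ^ 2 * (2 * (d : ℝ) + 1) ^ 2 * (L : ℝ) ^ 2) ^ 2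
          + d * ((d : ℝ) + 1) * ((L : ℝ) ^ 3 * (256 * (d : ℝ) ^ 2
              * (32 * d + (24 * d * (2 * (d : ℝ) + gradRem d) + 14336 * (d : ℝ) ^ 2 * ((d : ℝ) + 1) ^ 2)
                + 12 * (2 * (d : ℝ) + gradRem d))
            + 4 * (24 * d * (2 * (d : ℝ) + gradRem d) + 14336 * (d : ℝ) ^ 2 * ((d : ℝ) + 1) ^ 2)
            + 24 * (2 * (d : ℝ) + gradRem d)))
          + ((d : ℝ) - 1) ^ 2 * (37 * ((d : ℝ) - 1) + 5))) * (L : ℝ) ^ (d + 2)) * t ≤ C_r)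
    {dom : Set (Site d → Fin d → (Matrix n n ℂ)ˣ)} (hTE : NE3EnergyRate d (ClassSix d L N ε₀) L N b (gradConst d c) C dom)
    {sel : ℕ → (Site d → Fin d → (Matrix n n ℂ)ˣ) → (Site d → Fin d → (Matrix n n ℂ)ˣ)}
    (hmin : ∀ V ∈ dom, ∀ k, IsMinimiser d (ClassSix d L N ε₀) L N k V (sel k V))
    (hreg : ∀ V ∈ dom, ∀ k, RegularSup d L N b c k (sel k V))
    (h4 : ∀ V ∈ dom, ∀ (k : ℕ) (U : Site d → Fin d → (Matrix n n ℂ)ˣ),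
      IsMinimiser d (ClassSix d L N ε₀) L N (k + 1) V U → RegularSup d L N b c (k + 1) U →
        rescale L (bavg L U) ∈ ClassSix (n := n) d L N ε₀ k) :
    NE3Shape
      (minActReadings d (ClassSix d L N ε₀) L N dom
        (fun k V (x : ↥(periodBox (d := d) N)) =>
          fineAction (sel k V) (((blockSites L)^[k] {(x : Site d)}) ×ˢ Finset.univ)))
      (max (wallConstNA d L * (gradConst d 1 + 1) / (L : ℝ) ^ 2)
        (wallConstLoc d L * (2500 * (L : ℝ) ^ 3 * Fintype.card (T4AveragingDeficitWall.Plane d) * (b * c + c ^ 2) + b ^ 3)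
          + ((b + 23142400 * b ^ 2) * Real.sqrt (Fintype.card (T4AveragingDeficitWall.Plane d))
              * (C * (wallConst d L * (N : ℝ) ^ 2 * (Real.sqrt (gradConst d c) * dualC2 d L + 2 * b ^ 2 * dualC1 d L)))
            + 14 * Fintype.card (T4AveragingDeficitWall.Plane d)
              * (C * (wallConst d L * (N : ℝ) ^ 2 * (Real.sqrt (gradConst d c) * dualC2 d L + 2 * b ^ 2 * dualC1 d L))) ^ 2)
        + Fintype.card (T4AveragingDeficitWall.Plane d) * b ^ 2))
      ((L : ℝ)⁻¹) := by
  subst hd4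
  have hL1 : 1 ≤ L := le_trans (by norm_num) hL
  exact ne3Shape_thm1Type_crude_mem rfl hL hN hb hc hbt hct hC (by linarith) hCle hT1 hT2 hT3 hB hCr hTE hmin hreg h4
    (fun _ _ hU => mem_classSix_of_regularSup hL1 hB0 hB4 hBε hCε hU)

end

end Summit.QuantumFields.BalabanUV.T4Continuum.NE3ShapeClassSixTorus
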